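import Literature.AlgebraicGeometry.Frobenioids.PiNatFixedPoints
import Literature.AnabelianGeometry.EtaleTheta.NoPhantomSupportCountable
import HarnessLib

/-!
# `∏_J ℤ≥0`: the invariants under any group of automorphisms have COUNTABLY many primes when `J` is countable

Mochizuki, *The geometry of Frobenioids I*, Kyushu J. Math. **62** (2008), §0 p. 12 (primary elements, primes)
[cite: MochizukiFrdI2008, §0 p.12]; Mochizuki, *The étale theta function …*, Publ. RIMS **45** (2009), Rmk. 3.3.1
PDF p. 73 ("the set of primes of the monoid `Div⁺(Z^log_∞)^{Gal(Z^log_∞/Y^log)}` … is in natural bijective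
correspondence with the set of `Gal(Z^log_∞/Y^log)`-orbits of prime log-divisors") and Def. 3.1 (i) p. 70 (prime
log-divisors = irreducible components of the special fibre and cusps of the universal combinatorial covering —
countably many) [cite: MochizukiEtTh2009, Rmk 3.3.1 p.73].

abc-iut cell, seat abc-iut-w5-d153 (gen 4).  PROOF-ONLY (theorems only), sequel of abc-iut-w6-d057's
`PiNatFixedPoints.lean` (p433433: `(∏_J ℤ≥0)^Γ ≅ ∏_{J/Γ} ℤ≥0`) and abc-iut-L2-d2's `NoPhantomSupportCountable.lean`:

* `PiNat.exists_common_dvd_of_coeff_ne_zero` — two `Γ`-invariants with a common support point have a common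
  non-trivial divisor INSIDE `(∏_J ℤ≥0)^Γ` (their pointwise minimum is again invariant, since `Aut(∏_J ℤ≥0)` acts
  through coordinate permutations);
* **`PiNat.countable_primes_fixedPoints`** — for countable `J` and ANY `Γ ≤ Aut(∏_J ℤ≥0)`, `Prime((∏_J ℤ≥0)^Γ)` is
  countable: sending a prime to a support point of one of its primary elements is injective (primaries of distinct
  primes are coprime); `PiNat.countable_primes_perfection_fixedPoints` — the same for the perfection.

Use (this seat's `RealificationMapInjectiveCountableSupp(Weak).lean`): hypothesis (c) "countably many primes" of the
`Λ = ℝ` injectivity reductions, discharged at the genuine [EtTh] Def. 3.3 (iii) record in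
`EtaleTheta/Discharge/Sec3PhiZeroCountablePrimes.lean`.  HONEST FRAMING: elementary monoid algebra; nothing here
bears on [IUTchIII] Cor. 3.12.
-/

noncomputable section

namespace Literature.AlgebraicGeometry.Frobenioids

open Function

universe u

namespace PiNat

variable {J : Type u}

/-- **A common support point gives a common non-trivial divisor inside `(∏_J ℤ≥0)^Γ`**: the pointwise minimum of
two `Γ`-invariants is `Γ`-invariant (automorphisms permute the coordinates), non-trivial at the common support
point, and divides both (the differences are invariant too). [cite: MochizukiFrdI2008, §0 p.12] -/
theorem exists_common_dvd_of_coeff_ne_zero (Γ : Subgroup (MulAut (Multiplicative (J → ℕ))))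
    {p p' : ↥(FixedPoints.submonoid Γ (Multiplicative (J → ℕ)))} {j : J}
    (hp : coeff p.1 j ≠ 0) (hp' : coeff p'.1 j ≠ 0) :
    ∃ z : ↥(FixedPoints.submonoid Γ (Multiplicative (J → ℕ))), z ≠ 1 ∧ z ∣ p ∧ z ∣ p' := by
  classical
  -- invariance = exponents constant along the coordinate permutations of `Γ`
  have hinv : ∀ f : Multiplicative (J → ℕ),
      (∀ i i' : J, (∃ γ ∈ Γ, γ (single i 1) = single i' 1) → coeff f i' = coeff f i) →
        f ∈ FixedPoints.submonoid Γ (Multiplicative (J → ℕ)) := by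
    intro f hf
    rw [mem_fixedPoints_iff]
    exact fun γ hγ i i' h => hf i i' ⟨γ, hγ, h⟩
  have hp_c : ∀ i i' : J, (∃ γ ∈ Γ, γ (single i 1) = single i' 1) → coeff p.1 i' = coeff p.1 i :=
    fun i i' ⟨γ, hγ, h⟩ => (mem_fixedPoints_iff Γ p.1).mp p.2 γ hγ i i' h
  have hp'_c : ∀ i i' : J, (∃ γ ∈ Γ, γ (single i 1) = single i' 1) → coeff p'.1 i' = coeff p'.1 i :=
    fun i i' ⟨γ, hγ, h⟩ => (mem_fixedPoints_iff Γ p'.1).mp p'.2 γ hγ i i' h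
  -- the pointwise minimum and the two differences
  let zv : Multiplicative (J → ℕ) := Multiplicative.ofAdd fun i => min (coeff p.1 i) (coeff p'.1 i)
  let wv : Multiplicative (J → ℕ) := Multiplicative.ofAdd fun i => coeff p.1 i - min (coeff p.1 i) (coeff p'.1 i)
  let wv' : Multiplicative (J → ℕ) := Multiplicative.ofAdd fun i => coeff p'.1 i - min (coeff p.1 i) (coeff p'.1 i)
  have hz : zv ∈ FixedPoints.submonoid Γ (Multiplicative (J → ℕ)) :=
    hinv zv fun i i' h => by simp only [zv, coeff, toAdd_ofAdd, hp_c i i' h, hp'_c i i' h]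
  have hw : wv ∈ FixedPoints.submonoid Γ (Multiplicative (J → ℕ)) :=
    hinv wv fun i i' h => by simp only [wv, coeff, toAdd_ofAdd, hp_c i i' h, hp'_c i i' h]
  have hw' : wv' ∈ FixedPoints.submonoid Γ (Multiplicative (J → ℕ)) :=
    hinv wv' fun i i' h => by simp only [wv', coeff, toAdd_ofAdd, hp_c i i' h, hp'_c i i' h]
  refine ⟨⟨zv, hz⟩, ?_, ⟨⟨wv, hw⟩, Subtype.ext (PiNat.ext fun i => ?_)⟩,
    ⟨⟨wv', hw'⟩, Subtype.ext (PiNat.ext fun i => ?_)⟩⟩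
  · intro h1
    have h2 : coeff zv j = 0 := by
      have := congrArg (fun z : ↥(FixedPoints.submonoid Γ (Multiplicative (J → ℕ))) => coeff z.1 j) h1
      simpa using this
    simp only [zv, coeff, toAdd_ofAdd] at h2
    rcases Nat.le_total (coeff p.1 j) (coeff p'.1 j) with h | h
    · exact hp (by rw [min_eq_left h] at h2; exact h2)
    · exact hp' (by rw [min_eq_right h] at h2; exact h2)
  · change coeff p.1 i = coeff (zv * wv) i
    rw [coeff_mul]
    simp only [zv, wv, coeff, toAdd_ofAdd]
    exact (Nat.add_sub_of_le (min_le_left _ _)).symm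
  · change coeff p'.1 i = coeff (zv * wv') i
    rw [coeff_mul]
    simp only [zv, wv', coeff, toAdd_ofAdd]
    exact (Nat.add_sub_of_le (min_le_right _ _)).symm

/-- **`Prime((∏_J ℤ≥0)^Γ)` is countable for countable `J`** (any `Γ ≤ Aut(∏_J ℤ≥0)`): choose for each prime a primary
representative and a point of its support; primaries of DISTINCT primes have no common non-trivial divisor, so by
`exists_common_dvd_of_coeff_ne_zero` the chosen points are distinct. [cite: MochizukiEtTh2009, Rmk 3.3.1 p.73] -/
theorem countable_primes_fixedPoints [Countable J] (Γ : Subgroup (MulAut (Multiplicative (J → ℕ)))) :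
    Countable (Primes ↥(FixedPoints.submonoid Γ (Multiplicative (J → ℕ)))) := by
  classical
  -- every prime has a primary member with a support point
  have key : ∀ 𝔭 : Primes ↥(FixedPoints.submonoid Γ (Multiplicative (J → ℕ))),
      ∃ (j : J) (p : ↥(FixedPoints.submonoid Γ (Multiplicative (J → ℕ)))), p ∈ 𝔭.carrier ∧ coeff p.1 j ≠ 0 := by
    intro 𝔭
    obtain ⟨⟨p, hp'⟩, hp⟩ := Quotient.exists_rep 𝔭
    have hpc : p ∈ 𝔭.carrier := ⟨hp', hp⟩
    have hne : ∃ j, coeff p.1 j ≠ 0 := by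
      by_contra h
      apply hp'.1
      apply Subtype.ext
      refine PiNat.ext fun j => ?_
      have hj : coeff p.1 j = 0 := by
        by_contra hj
        exact h ⟨j, hj⟩
      rw [hj]
      rfl
    obtain ⟨j, hj⟩ := hne
    exact ⟨j, p, hpc, hj⟩
  choose pt rep hrep hpt using key
  refine (show Injective pt from fun 𝔭 𝔮 h => ?_).countable
  obtain ⟨z, hz1, hzp, hzq⟩ := exists_common_dvd_of_coeff_ne_zero Γ (hpt 𝔭) (h ▸ hpt 𝔮)
  have hz𝔭 : z ∈ 𝔭.carrier := 𝔭.mem_carrier_of_precsim (hrep 𝔭) hz1 (Precsim.of_dvd hzp)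
  have hz𝔮 : z ∈ 𝔮.carrier := 𝔮.mem_carrier_of_precsim (hrep 𝔮) hz1 (Precsim.of_dvd hzq)
  obtain ⟨h₁, rfl⟩ := hz𝔭
  obtain ⟨h₂, rfl⟩ := hz𝔮
  rfl

/-- … hence `Prime(((∏_J ℤ≥0)^Γ)^pf)` is countable as well (`Prime(M) ≃ Prime(M^pf)` for the sharp monoid
`(∏_J ℤ≥0)^Γ`). [cite: MochizukiFrdI2008, §0 p.12] -/
theorem countable_primes_perfection_fixedPoints [Countable J] (Γ : Subgroup (MulAut (Multiplicative (J → ℕ)))) :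
    Countable (Primes (Perfection ↥(FixedPoints.submonoid Γ (Multiplicative (J → ℕ))))) := by
  classical
  haveI := countable_primes_fixedPoints (J := J) Γ
  exact (isPerfFactorialWeak_fixedPoints Γ).countable_primes_perfection

end PiNat

end Literature.AlgebraicGeometry.Frobenioids

end
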